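import Literature.Probability.LatticeModels.LeeYang
import HarnessLib

/-!
# The Lee–Yang circle theorem for finite ferromagnets: discharge of the named fact

Sibling proof file of `Literature.Probability.LatticeModels.LeeYang` (which holds the D-0014 named
fact and is review-gated; the proof lives here). It discharges

* `Literature.Probability.LatticeModels.lee_yang_circle_theorem_finite` — for `n` Ising spins `σᵢ = ±1`, couplings
  `J i j ≥ 0` (any non-negative matrix, summed over ordered pairs, diagonal included) and complex
  fields with `0 < Re (h i)`, the partition function
  `∑_σ exp (∑ᵢ ∑ⱼ Jᵢⱼ σᵢσⱼ + ∑ᵢ hᵢ σᵢ)` is non-zero (Lee–Yang 1952, Appendix II; in the form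
  of Friedli–Velenik 2017, Theorem 3.43 with eq. (3.52) and Remark 3.45),

as `lee_yang_circle_theorem_finite_holds`, with a self-contained proof by Asano contractions
following Friedli–Velenik (2017), §3.7.4, proof of Theorem 3.43, printed pp. 129–133 = PDF
pp. 135–139; page numbers below are PDF pages (induction on the
edge set for the multi-affine polynomial `P̂_E(z_V) = ∑_X a_E(X) ∏_{i∈X} zᵢ`, eq. (3.52):
`|zᵢ| < 1 ∀ i ⇒ P̂_E ≠ 0`; Asano contraction, Case 2 and Lemma 3.44; edge-dependent couplings,
Remark 3.45).

## Proof architecture (namespace `Literature.StatMech.LeeYangCircle`)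

1. `asano_contraction` — the Asano–Ruelle contraction lemma in open-disc form: if
   `a + bζ + cη + dζη ≠ 0` for `|ζ|, |η| < 1` then `a + dζ ≠ 0` for `|ζ| < 1`. Proof: `a ≠ 0`;
   freezing one variable gives `‖c + dζ‖ ≤ ‖a + bζ‖` and `‖b + dη‖ ≤ ‖a + cη‖` on the disc
   (`norm_le_of_forall_ne_zero`); evaluating at `±r` and adding (parallelogram identity) yields
   `‖d‖² r² ≤ ‖a‖²` for all `r < 1`, hence `‖d‖ ≤ ‖a‖`. (Friedli–Velenik argue instead with the
   product of the two roots of `z ↦ P̂(z, z)`, p. 138; the conclusion is the same.)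
2. `edge_ne_zero` — the one-edge polynomial `1 + t u + t v + u v`, `t = e^{-2J} ∈ [0,1]`, has no
   zero in the open bidisc (base case, p. 136 / Exercise 3.27):
   `|1 + tu|² − |t + u|² = (1 − t²)(1 − |u|²) ≥ 0`.
3. `asano_edge` — gluing one edge onto a bi-affine zero-free polynomial by two contractions
   (Cases 2–3, pp. 137–138): `a + bζ + cη + dζη ≠ 0` on the bidisc implies
   `a + t bζ + t cη + dζη ≠ 0` on the bidisc.
4. The multi-affine polynomial of a weight `w` on `σ : ι → Bool` is written out everywhere as
   `∑_σ w σ ∏ₖ [σ k ? 1 : z k]` (spin `false` = "down" = `k ∈ X` carries the fugacity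
   `z k = e^{-2 h k}`; no auxiliary definition is introduced, this being a pure proof file). It
   is affine in each variable (`exists_affine_update`, via `prod_ite_update`), multiplying the
   weight by the spin `sᵢ = ±1` flips `zᵢ ↦ −zᵢ` (`sum_mul_spin`), and the edge Boltzmann factor
   is `[σᵢ = σⱼ ? 1 : t] = (1+t)/2 + (1−t)/2 · sᵢsⱼ` (`sum_mul_edge`).
5. `lyProp_mul_edge` (the induction step: one more ferromagnetic edge factor keeps the
   polynomial zero-free on the open polydisc), `sum_prod_ite_ne_zero` (empty edge set:
   `∏ₖ (1 + z k) ≠ 0`), `lyProp_prod_edges` (induction over a `Finset (ι × ι)` of ordered pairs;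
   a diagonal pair contributes the factor `1`).
6. `lee_yang_circle_theorem_finite_holds`: `exp (Jᵢⱼ σᵢσⱼ) = e^{Jᵢⱼ} [σᵢ = σⱼ ? 1 : e^{-2Jᵢⱼ}]`
   and `exp (hᵢσᵢ) = e^{hᵢ} [σᵢ ? 1 : zᵢ]`, so
   `Z = (∏ᵢⱼ e^{Jᵢⱼ}) (∏ᵢ e^{hᵢ}) · ∑_σ w σ ∏ᵢ [σᵢ ? 1 : zᵢ]` with `w` the product of all edge
   factors and `‖zᵢ‖ = e^{-2 Re hᵢ} < 1` (Friedli–Velenik p. 136, first display).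

## References

* T. D. Lee, C. N. Yang, *Statistical theory of equations of state and phase transitions. II.
  Lattice gas and Ising model*, Phys. Rev. 87 (1952), 410–419, Appendix II. [LeeYang1952]
* T. Asano, *Theorems on the partition functions of the Heisenberg ferromagnets*, J. Phys. Soc.
  Japan 29 (1970), 350–359. [Asano1970]
* S. Friedli, Y. Velenik, *Statistical Mechanics of Lattice Systems*, CUP 2017, §3.7.4,
  Theorems 3.42–3.43, Lemma 3.44, Remark 3.45, printed pp. 128–133 (PDF pp. 134–139).
  [FriedliVelenik2017]
* D. Ruelle, *Extension of the Lee–Yang circle theorem*, Phys. Rev. Lett. 26 (1971), 303–304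
  (the contraction lemma with general closed sets `A`, `B ∌ 0`).
-/

noncomputable section

open scoped BigOperators

namespace Literature.Probability.LatticeModels

namespace LeeYangCircle

/-! ### Step 1: the (open-disc) Asano contraction lemma -/

/-- If `α + β η ≠ 0` for every `η` in the open unit disc then `‖β‖ ≤ ‖α‖` (otherwise `η = -α/β`
is a root in the disc). Elementary. [folklore] -/
theorem norm_le_of_forall_ne_zero {α β : ℂ} (h : ∀ η : ℂ, ‖η‖ < 1 → α + β * η ≠ 0) :
    ‖β‖ ≤ ‖α‖ := by
  by_contra hlt
  push Not at hlt
  have hβ : β ≠ 0 := by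
    rintro rfl
    exact absurd (by simpa using hlt) (not_lt.mpr (norm_nonneg α))
  have hβ' : 0 < ‖β‖ := norm_pos_iff.mpr hβ
  refine h (-α / β) ?_ ?_
  · rw [norm_div, norm_neg, div_lt_one hβ']
    exact hlt
  · field_simp
    ring

/-- Parallelogram identity in `ℂ`, squared-norm form. Elementary. [folklore] -/
theorem norm_add_sq_add_norm_sub_sq (x y : ℂ) :
    ‖x + y‖ ^ 2 + ‖x - y‖ ^ 2 = 2 * ‖x‖ ^ 2 + 2 * ‖y‖ ^ 2 := by
  simp only [Complex.sq_norm, Complex.normSq_add, Complex.normSq_sub]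
  ring

/-- **Asano contraction lemma** (open-disc form). If the bi-affine polynomial
`a + b ζ + c η + d ζ η` has no zero with `‖ζ‖ < 1`, `‖η‖ < 1`, then its Asano contraction `a + d ζ`
has no zero with `‖ζ‖ < 1`. Proof: `a ≠ 0`; freezing one variable, `norm_le_of_forall_ne_zero`
gives `‖c + dζ‖ ≤ ‖a + bζ‖` and `‖b + dη‖ ≤ ‖a + cη‖` on the disc; at `±r` the parallelogram
identity yields `‖d‖² r² ≤ ‖a‖²` for every `r < 1`, so `‖d‖ ≤ ‖a‖` and `‖dζ‖ < ‖a‖`.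
(Friedli–Velenik obtain `|P̂⁺⁺| ≥ |P̂⁻⁻|` from the product of the roots of `z ↦ P̂(z,z)` instead,
PDF p. 138.)
[cite: FriedliVelenik2017, §3.7.4, proof of Thm 3.43, Case 2 (Asano contraction, PDF p. 138)]
[cite: Asano1970] -/
theorem asano_contraction {a b c d : ℂ}
    (H : ∀ ζ η : ℂ, ‖ζ‖ < 1 → ‖η‖ < 1 → a + b * ζ + c * η + d * ζ * η ≠ 0) :
    ∀ ζ : ℂ, ‖ζ‖ < 1 → a + d * ζ ≠ 0 := by
  have ha : a ≠ 0 := by simpa using H 0 0 (by simp) (by simp)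
  have h1 : ∀ ζ : ℂ, ‖ζ‖ < 1 → ‖c + d * ζ‖ ≤ ‖a + b * ζ‖ := fun ζ hζ =>
    norm_le_of_forall_ne_zero fun η hη => by
      have := H ζ η hζ hη
      convert this using 1
      ring
  have h2 : ∀ η : ℂ, ‖η‖ < 1 → ‖b + d * η‖ ≤ ‖a + c * η‖ := fun η hη =>
    norm_le_of_forall_ne_zero fun ζ hζ => by
      have := H ζ η hζ hη
      convert this using 1
      ring
  -- radial bound: `‖d‖² r² ≤ ‖a‖²` for `0 ≤ r < 1`
  have key : ∀ r : ℝ, 0 ≤ r → r < 1 → ‖d‖ ^ 2 * r ^ 2 ≤ ‖a‖ ^ 2 := by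
    intro r hr0 hr1
    have hr : ‖(r : ℂ)‖ < 1 := by rw [Complex.norm_of_nonneg hr0]; exact hr1
    have hr' : ‖(-(r : ℂ))‖ < 1 := by rwa [norm_neg]
    have sq : ∀ {x y : ℂ}, ‖x‖ ≤ ‖y‖ → ‖x‖ ^ 2 ≤ ‖y‖ ^ 2 := fun hxy =>
      pow_le_pow_left₀ (norm_nonneg _) hxy 2
    have e1 := sq (h1 r hr)
    have e2 := sq (h1 (-r) hr')
    have e3 := sq (h2 r hr)
    have e4 := sq (h2 (-r) hr')
    have p1 := norm_add_sq_add_norm_sub_sq a (b * r)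
    have p2 := norm_add_sq_add_norm_sub_sq c (d * r)
    have p3 := norm_add_sq_add_norm_sub_sq a (c * r)
    have p4 := norm_add_sq_add_norm_sub_sq b (d * r)
    have nb : ‖b * r‖ = ‖b‖ * r := by rw [norm_mul, Complex.norm_of_nonneg hr0]
    have nc : ‖c * r‖ = ‖c‖ * r := by rw [norm_mul, Complex.norm_of_nonneg hr0]
    have nd : ‖d * r‖ = ‖d‖ * r := by rw [norm_mul, Complex.norm_of_nonneg hr0]
    simp only [mul_neg, ← sub_eq_add_neg] at e2 e4
    rw [nb] at p1
    rw [nd] at p2 p4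
    rw [nc] at p3
    have hbc : 0 ≤ (‖b‖ ^ 2 + ‖c‖ ^ 2) * (1 - r ^ 2) :=
      mul_nonneg (by positivity) (by nlinarith)
    nlinarith [e1, e2, e3, e4, p1, p2, p3, p4, hbc]
  -- hence `‖d‖ ≤ ‖a‖`
  have hda : ‖d‖ ≤ ‖a‖ := by
    by_contra hlt
    push Not at hlt
    have hd : 0 < ‖d‖ := (norm_nonneg a).trans_lt hlt
    set r : ℝ := (‖a‖ + ‖d‖) / (2 * ‖d‖) with hr
    have hr0 : 0 ≤ r := by positivity
    have hr1 : r < 1 := by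
      rw [hr, div_lt_one (by positivity)]
      linarith
    have := key r hr0 hr1
    have hdr : ‖d‖ * r = (‖a‖ + ‖d‖) / 2 := by
      rw [hr]; field_simp
    nlinarith [this, hdr, norm_nonneg a]
  intro ζ hζ hzero
  have : ‖a‖ = ‖d‖ * ‖ζ‖ := by
    have : a = -(d * ζ) := by linear_combination hzero
    rw [this, norm_neg, norm_mul]
  have hlt : ‖d‖ * ‖ζ‖ < ‖a‖ := by
    calc ‖d‖ * ‖ζ‖ ≤ ‖a‖ * ‖ζ‖ := by gcongr
      _ < ‖a‖ * 1 := mul_lt_mul_of_pos_left hζ (norm_pos_iff.mpr ha)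
      _ = ‖a‖ := mul_one _
  exact (lt_irrefl _) (this ▸ hlt)

/-- The single-edge Lee–Yang polynomial `1 + t u + t v + u v` (`t = e^{-2J} ∈ [0,1]`) has no zero
in the open bidisc: `|1 + tu|² − |t + u|² = (1 − t²)(1 − |u|²) ≥ 0`, so a zero forces `|v| ≥ 1`
(the Möbius map `z ↦ −(tz+1)/(z+t)` exchanges the interior and exterior of the unit disc).
[cite: FriedliVelenik2017, §3.7.4, proof of Thm 3.43 (single edge), Exercise 3.27] -/
theorem edge_ne_zero {t : ℝ} (ht0 : 0 ≤ t) (ht1 : t ≤ 1) {u v : ℂ} (hu : ‖u‖ < 1) (hv : ‖v‖ < 1) :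
    1 + t * u + t * v + u * v ≠ 0 := by
  intro h0
  have hkey : ‖(t : ℂ) + u‖ ^ 2 ≤ ‖1 + t * u‖ ^ 2 := by
    have : ‖1 + (t : ℂ) * u‖ ^ 2 - ‖(t : ℂ) + u‖ ^ 2 = (1 - t ^ 2) * (1 - ‖u‖ ^ 2) := by
      simp only [Complex.sq_norm, Complex.normSq_apply, Complex.add_re, Complex.add_im,
        Complex.mul_re, Complex.mul_im, Complex.ofReal_re, Complex.ofReal_im, Complex.one_re,
        Complex.one_im]
      ring
    have hu2 : ‖u‖ ^ 2 ≤ 1 := by nlinarith [norm_nonneg u]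
    nlinarith [mul_nonneg (by nlinarith : (0:ℝ) ≤ 1 - t ^ 2) (by linarith : (0:ℝ) ≤ 1 - ‖u‖ ^ 2)]
  have h1 : 1 + (t : ℂ) * u = -((t + u) * v) := by linear_combination h0
  have hn : ‖1 + (t : ℂ) * u‖ = ‖(t : ℂ) + u‖ * ‖v‖ := by rw [h1, norm_neg, norm_mul]
  by_cases htu : ‖(t : ℂ) + u‖ = 0
  · have : 1 + (t : ℂ) * u = 0 := by simpa [htu] using hn
    have : ‖(t : ℂ) * u‖ = 1 := by
      have e : (t : ℂ) * u = -1 := by linear_combination this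
      rw [e, norm_neg, norm_one]
    rw [norm_mul, Complex.norm_of_nonneg ht0] at this
    nlinarith [norm_nonneg u]
  · have hpos : 0 < ‖(t : ℂ) + u‖ := lt_of_le_of_ne (norm_nonneg _) (Ne.symm htu)
    have : ‖(t : ℂ) + u‖ * ‖v‖ < ‖(t : ℂ) + u‖ * 1 := by gcongr
    rw [mul_one, ← hn] at this
    nlinarith [norm_nonneg (1 + (t : ℂ) * u), norm_nonneg ((t : ℂ) + u)]

/-- **Two Asano contractions with an edge.** If `a + b ζ + c η + d ζ η ≠ 0` on the open bidisc, then
for `t ∈ [0,1]` also `a + t b ζ + t c η + d ζ η ≠ 0` on the open bidisc: multiply by the edge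
polynomial `1 + t u + t v + u v` in fresh variables (zero-free by `edge_ne_zero`) and contract
`ζ ~ u`, then `η ~ v` (`asano_contraction` twice, each with the remaining variables frozen).
[cite: FriedliVelenik2017, §3.7.4, proof of Thm 3.43, Cases 2–3 (virtual edge, Asano contractions)]
-/
theorem asano_edge {a b c d : ℂ} {t : ℝ} (ht0 : 0 ≤ t) (ht1 : t ≤ 1)
    (H : ∀ ζ η : ℂ, ‖ζ‖ < 1 → ‖η‖ < 1 → a + b * ζ + c * η + d * ζ * η ≠ 0) :
    ∀ ζ η : ℂ, ‖ζ‖ < 1 → ‖η‖ < 1 → a + t * b * ζ + t * c * η + d * ζ * η ≠ 0 := by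
  -- first contraction `ζ ~ u` (with `η`, `v` frozen in the disc)
  have step1 : ∀ η v : ℂ, ‖η‖ < 1 → ‖v‖ < 1 → ∀ ζ : ℂ, ‖ζ‖ < 1 →
      (a + c * η) * (1 + t * v) + (b + d * η) * (t + v) * ζ ≠ 0 := by
    intro η v hη hv
    have := asano_contraction (a := (a + c * η) * (1 + t * v)) (b := (a + c * η) * (t + v))
      (c := (b + d * η) * (1 + t * v)) (d := (b + d * η) * (t + v)) ?_
    · intro ζ hζ
      have h := this ζ hζ
      convert h using 1
    · intro u ζ hu hζ
      have hP := H ζ η hζ hη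
      have hE := edge_ne_zero ht0 ht1 hu hv
      have : (a + c * η) * (1 + ↑t * v) + (a + c * η) * (↑t + v) * u +
          (b + d * η) * (1 + ↑t * v) * ζ + (b + d * η) * (↑t + v) * u * ζ =
          (a + b * ζ + c * η + d * ζ * η) * (1 + t * u + t * v + u * v) := by ring
      rw [this]
      exact mul_ne_zero hP hE
  -- second contraction `η ~ v` (with `ζ` frozen in the disc)
  intro ζ η hζ hη
  have := asano_contraction (a := a + t * b * ζ) (b := c + d * t * ζ) (c := a * t + b * ζ)
    (d := c * t + d * ζ) ?_
  · have h := this η hη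
    convert h using 1
    ring
  · intro η' v hη' hv
    have h := step1 η' v hη' hv ζ hζ
    convert h using 1
    ring

/-! ### Step 2: the multi-affine polynomial `∑_σ w σ ∏ₖ [σ k ? 1 : z k]` of a spin weight -/

variable {ι : Type*} [Fintype ι] [DecidableEq ι]

/-- A finite sum of affine functions `ζ ↦ α + β ζ` is affine. Elementary. [folklore] -/
theorem exists_affine_sum {κ : Type*} (s : Finset κ) {F : κ → ℂ → ℂ}
    (h : ∀ k ∈ s, ∃ α β : ℂ, ∀ ζ, F k ζ = α + β * ζ) :
    ∃ α β : ℂ, ∀ ζ, ∑ k ∈ s, F k ζ = α + β * ζ := by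
  classical
  induction s using Finset.induction_on with
  | empty => exact ⟨0, 0, fun ζ => by simp⟩
  | insert k s hk ih =>
    obtain ⟨α, β, hαβ⟩ := h k (Finset.mem_insert_self k s)
    obtain ⟨α', β', hαβ'⟩ := ih fun k' hk' => h k' (Finset.mem_insert_of_mem hk')
    refine ⟨α + α', β + β', fun ζ => ?_⟩
    rw [Finset.sum_insert hk, hαβ, hαβ']
    ring

/-- Splitting off the `i`-th factor of the monomial `∏ₖ [σ k ? 1 : z k]` at an updated point.
Elementary. [folklore] -/
theorem prod_ite_update (σ : ι → Bool) (z : ι → ℂ) (i : ι) (ζ : ℂ) :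
    ∏ k, (if σ k then (1 : ℂ) else Function.update z i ζ k) =
      (if σ i then 1 else ζ) * ∏ k ∈ Finset.univ.erase i, (if σ k then 1 else z k) := by
  rw [← Finset.mul_prod_erase Finset.univ _ (Finset.mem_univ i), Function.update_self]
  congr 1
  refine Finset.prod_congr rfl fun k hk => ?_
  rw [Function.update_of_ne (Finset.ne_of_mem_erase hk)]

/-- One weighted monomial is affine in the variable `z i`. Elementary. [folklore] -/
theorem exists_affine_term (w : (ι → Bool) → ℂ) (z : ι → ℂ) (i : ι) (σ : ι → Bool) :
    ∃ α β : ℂ, ∀ ζ, w σ * ∏ k, (if σ k then (1 : ℂ) else Function.update z i ζ k) = α + β * ζ := by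
  refine ⟨w σ * ((if σ i then 1 else 0) * ∏ k ∈ Finset.univ.erase i, (if σ k then 1 else z k)),
    w σ * ((if σ i then 0 else 1) * ∏ k ∈ Finset.univ.erase i, (if σ k then 1 else z k)),
    fun ζ => ?_⟩
  rw [prod_ite_update]
  cases σ i
  · simp only [Bool.false_eq_true, if_false]; ring
  · simp only [if_true]; ring

/-- The multi-affine polynomial `∑_σ w σ ∏ₖ [σ k ? 1 : z k]` is affine in each variable `z i`
separately. Elementary. [folklore] -/
theorem exists_affine_update (w : (ι → Bool) → ℂ) (z : ι → ℂ) (i : ι) :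
    ∃ α β : ℂ, ∀ ζ,
      (∑ σ : ι → Bool, w σ * ∏ k, (if σ k then (1 : ℂ) else Function.update z i ζ k)) =
        α + β * ζ :=
  exists_affine_sum Finset.univ
    (F := fun σ ζ => w σ * ∏ k, (if σ k then (1 : ℂ) else Function.update z i ζ k))
    fun σ _ => exists_affine_term w z i σ

/-- A separately affine function of two complex variables is `a + b ζ + c η + d ζ η`.
Elementary. [folklore] -/
theorem exists_biaffine_repr {F : ℂ → ℂ → ℂ} (h1 : ∀ η, ∃ α β : ℂ, ∀ ζ, F ζ η = α + β * ζ)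
    (h2 : ∀ ζ, ∃ α β : ℂ, ∀ η, F ζ η = α + β * η) :
    ∃ a b c d : ℂ, ∀ ζ η, F ζ η = a + b * ζ + c * η + d * ζ * η := by
  obtain ⟨a, b, hab⟩ := h1 0
  obtain ⟨a', b', hab'⟩ := h1 1
  refine ⟨a, b, a' - a, b' - b, fun ζ η => ?_⟩
  obtain ⟨α, β, hαβ⟩ := h2 ζ
  have e0 : F ζ 0 = α := by simpa using hαβ 0
  have e1 : F ζ 1 = α + β := by simpa using hαβ 1
  have f0 : F ζ 0 = a + b * ζ := hab ζ
  have f1 : F ζ 1 = a' + b' * ζ := hab' ζ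
  rw [hαβ η]
  have hα : α = a + b * ζ := by rw [← e0, f0]
  have hβ : β = (a' + b' * ζ) - (a + b * ζ) := by
    rw [← f1, ← f0, e1, e0]; ring
  rw [hα, hβ]
  ring

/-- Multiplying the weight by the spin `sᵢ = [σ i ? 1 : −1]` flips the sign of `z i` in the
polynomial. Elementary. [folklore] -/
theorem sum_mul_spin (w : (ι → Bool) → ℂ) (z : ι → ℂ) (i : ι) :
    ∑ σ : ι → Bool, w σ * (if σ i then 1 else -1) * ∏ k, (if σ k then (1 : ℂ) else z k) =
      ∑ σ : ι → Bool, w σ * ∏ k, (if σ k then (1 : ℂ) else Function.update z i (-z i) k) := by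
  refine Finset.sum_congr rfl fun σ _ => ?_
  rw [prod_ite_update,
    ← Finset.mul_prod_erase Finset.univ (fun k => if σ k then (1 : ℂ) else z k) (Finset.mem_univ i)]
  cases σ i <;> simp

/-- The edge Boltzmann factor in spin form, `[σ i = σ j ? 1 : t] = (1+t)/2 + (1−t)/2 · sᵢ sⱼ`,
summed against the monomials. Elementary. [folklore] -/
theorem sum_mul_edge (w : (ι → Bool) → ℂ) (z : ι → ℂ) (i j : ι) (t : ℂ) :
    ∑ σ : ι → Bool, w σ * (if σ i = σ j then 1 else t) * ∏ k, (if σ k then (1 : ℂ) else z k) =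
      (1 + t) / 2 * ∑ σ : ι → Bool, w σ * ∏ k, (if σ k then (1 : ℂ) else z k) +
        (1 - t) / 2 * ∑ σ : ι → Bool,
          w σ * ((if σ i then 1 else -1) * (if σ j then 1 else -1)) *
            ∏ k, (if σ k then (1 : ℂ) else z k) := by
  rw [Finset.mul_sum, Finset.mul_sum, ← Finset.sum_add_distrib]
  refine Finset.sum_congr rfl fun σ _ => ?_
  cases σ i <;> cases σ j <;> simp <;> ring

/-- **Edge addition** (induction step). If the polynomial of the weight `w` has no zero in the
open unit polydisc, neither has the polynomial of `w · [σ i = σ j ? 1 : t]` for one more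
ferromagnetic (ordered) pair `(i, j)` with `t ∈ [0,1]` (`t = e^{-2Jᵢⱼ}`; for `i = j` the factor
is `1`). Proof: freeze all variables but `z i`, `z j`; the polynomial is bi-affine
`a + b zᵢ + c zⱼ + d zᵢzⱼ` in them (`exists_biaffine_repr`) and zero-free on the bidisc, the new
one is `a + t b zᵢ + t c zⱼ + d zᵢzⱼ` (`sum_mul_edge`, `sum_mul_spin`), zero-free by `asano_edge`.
[cite: FriedliVelenik2017, §3.7.4, proof of Thm 3.43 (induction on |E|, Cases 1–3), Rem. 3.45] -/
theorem lyProp_mul_edge {w : (ι → Bool) → ℂ}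
    (hw : ∀ z : ι → ℂ, (∀ k, ‖z k‖ < 1) →
      (∑ σ : ι → Bool, w σ * ∏ k, (if σ k then (1 : ℂ) else z k)) ≠ 0)
    (i j : ι) {t : ℝ} (ht0 : 0 ≤ t) (ht1 : t ≤ 1) :
    ∀ z : ι → ℂ, (∀ k, ‖z k‖ < 1) →
      (∑ σ : ι → Bool, w σ * (if σ i = σ j then 1 else (t : ℂ)) *
        ∏ k, (if σ k then (1 : ℂ) else z k)) ≠ 0 := by
  by_cases hij : i = j
  · subst hij
    simpa using hw
  intro z hz
  -- the bi-affine function of the two distinguished variables, all others frozen at `z`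
  set F : ℂ → ℂ → ℂ := fun ζ η => ∑ σ : ι → Bool,
    w σ * ∏ k, (if σ k then (1 : ℂ) else Function.update (Function.update z i ζ) j η k) with hF
  have hF1 : ∀ η, ∃ α β : ℂ, ∀ ζ, F ζ η = α + β * ζ := by
    intro η
    simp only [hF, Function.update_comm hij]
    exact exists_affine_update w _ i
  have hF2 : ∀ ζ, ∃ α β : ℂ, ∀ η, F ζ η = α + β * η := fun ζ => exists_affine_update w _ j
  obtain ⟨a, b, c, d, habcd⟩ := exists_biaffine_repr hF1 hF2
  -- `F` has no zeros on the bidisc (all other variables are already in the disc)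
  have HF : ∀ ζ η : ℂ, ‖ζ‖ < 1 → ‖η‖ < 1 → a + b * ζ + c * η + d * ζ * η ≠ 0 := by
    intro ζ η hζ hη
    rw [← habcd]
    refine hw _ fun k => ?_
    rcases eq_or_ne k j with rfl | hkj
    · simpa using hη
    rw [Function.update_of_ne hkj]
    rcases eq_or_ne k i with rfl | hki
    · simpa using hζ
    rw [Function.update_of_ne hki]
    exact hz k
  have key := asano_edge ht0 ht1 HF (z i) (z j) (hz i) (hz j)
  -- identify the old polynomial and its doubly spin-flipped version as values of `F`
  have e1 : (∑ σ : ι → Bool, w σ * ∏ k, (if σ k then (1 : ℂ) else z k)) = F (z i) (z j) := by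
    simp only [hF, Function.update_eq_self]
  have e2 : (∑ σ : ι → Bool, w σ * ((if σ i then 1 else -1) * (if σ j then 1 else -1)) *
      ∏ k, (if σ k then (1 : ℂ) else z k)) = F (-z i) (-z j) := by
    calc (∑ σ : ι → Bool, w σ * ((if σ i then 1 else -1) * (if σ j then 1 else -1)) *
          ∏ k, (if σ k then (1 : ℂ) else z k))
        = ∑ σ : ι → Bool, w σ * (if σ j then 1 else -1) * (if σ i then 1 else -1) *
            ∏ k, (if σ k then (1 : ℂ) else z k) := by
          refine Finset.sum_congr rfl fun σ _ => ?_
          ring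
      _ = ∑ σ : ι → Bool, w σ * (if σ j then 1 else -1) *
            ∏ k, (if σ k then (1 : ℂ) else Function.update z i (-z i) k) :=
          sum_mul_spin (fun σ => w σ * (if σ j then 1 else -1)) z i
      _ = ∑ σ : ι → Bool, w σ * ∏ k, (if σ k then (1 : ℂ) else
            Function.update (Function.update z i (-z i)) j (-Function.update z i (-z i) j) k) :=
          sum_mul_spin w _ j
      _ = F (-z i) (-z j) := by
          simp only [hF, Function.update_of_ne (Ne.symm hij)]
  rw [sum_mul_edge, e1, e2, habcd, habcd]
  convert key using 1
  ring

/-- Empty edge set: `∑_σ ∏ₖ [σ k ? 1 : z k] = ∏ₖ (1 + z k) ≠ 0` on the open polydisc.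
Elementary. [folklore] -/
theorem sum_prod_ite_ne_zero (z : ι → ℂ) (hz : ∀ k, ‖z k‖ < 1) :
    (∑ σ : ι → Bool, ∏ k, (if σ k then (1 : ℂ) else z k)) ≠ 0 := by
  rw [← Fintype.prod_sum fun k (b : Bool) => if b then (1 : ℂ) else z k]
  rw [Finset.prod_ne_zero_iff]
  intro k _
  simp only [Fintype.sum_bool, if_true, Bool.false_eq_true, if_false]
  intro h0
  have h1 : z k = -1 := by linear_combination h0
  have := hz k
  rw [h1, norm_neg, norm_one] at this
  exact lt_irrefl _ this

/-- Products of ferromagnetic edge factors `[σ p.1 = σ p.2 ? 1 : t p.1 p.2]`, `t ∈ [0,1]`, over any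
finite set of ordered pairs have a polynomial with no zero in the open unit polydisc (induction on
the edge set from `sum_prod_ite_ne_zero` by `lyProp_mul_edge`). This is eq. (3.52) of
Friedli–Velenik with edge-dependent couplings.
[cite: FriedliVelenik2017, §3.7.4, eq. (3.52), Rem. 3.45] -/
theorem lyProp_prod_edges (t : ι → ι → ℝ) (ht0 : ∀ i j, 0 ≤ t i j) (ht1 : ∀ i j, t i j ≤ 1)
    (s : Finset (ι × ι)) :
    ∀ z : ι → ℂ, (∀ k, ‖z k‖ < 1) →
      (∑ σ : ι → Bool, (∏ p ∈ s, (if σ p.1 = σ p.2 then 1 else (t p.1 p.2 : ℂ))) *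
        ∏ k, (if σ k then (1 : ℂ) else z k)) ≠ 0 := by
  classical
  induction s using Finset.induction_on with
  | empty =>
    intro z hz
    simpa using sum_prod_ite_ne_zero z hz
  | insert p s hp ih =>
    have step := lyProp_mul_edge ih p.1 p.2 (ht0 p.1 p.2) (ht1 p.1 p.2)
    have hfun : ∀ σ : ι → Bool, (∏ q ∈ insert p s, (if σ q.1 = σ q.2 then 1 else (t q.1 q.2 : ℂ))) =
        (∏ q ∈ s, (if σ q.1 = σ q.2 then 1 else (t q.1 q.2 : ℂ))) *
          (if σ p.1 = σ p.2 then 1 else (t p.1 p.2 : ℂ)) := fun σ => by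
      rw [Finset.prod_insert hp, mul_comm]
    intro z hz
    simp_rw [hfun]
    exact step z hz

end LeeYangCircle

/-! ### Discharge -/

open LeeYangCircle in
/-- **Discharge of the named fact `lee_yang_circle_theorem_finite`** (Lee–Yang circle theorem,
multivariate finite form): for `n` spins, couplings `J i j ≥ 0` and fields with `0 < Re (h i)`,
`∑_{σ : Fin n → Bool} exp (∑ᵢ ∑ⱼ Jᵢⱼ [σᵢ = σⱼ ? 1 : −1] + ∑ᵢ hᵢ [σᵢ ? 1 : −1]) ≠ 0`.
Proof: with `zᵢ = e^{-2hᵢ}` (`‖zᵢ‖ = e^{-2 Re hᵢ} < 1`) and `tᵢⱼ = e^{-2Jᵢⱼ} ∈ (0,1]`, the sum is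
`(∏ᵢ∏ⱼ e^{Jᵢⱼ})(∏ᵢ e^{hᵢ}) · ∑_σ w σ ∏ᵢ [σᵢ ? 1 : zᵢ]` for the product `w` of the edge
factors `[σᵢ = σⱼ ? 1 : tᵢⱼ]` over all ordered pairs, and the last sum is `≠ 0` by
`LeeYangCircle.lyProp_prod_edges` (Asano contractions, edge by edge). This is Lee–Yang 1952,
Appendix II, in the multi-affine form of Friedli–Velenik 2017, Theorem 3.43 / eq. (3.52) with
edge-dependent couplings (Remark 3.45), proof §3.7.4, printed pp. 129–133 (PDF pp. 135–139).
[cite: LeeYang1952, Appendix II] [cite: FriedliVelenik2017, Thm 3.43, eq. (3.52), Rem. 3.45]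
[cite: Asano1970] -/
theorem lee_yang_circle_theorem_finite_holds : lee_yang_circle_theorem_finite := by
  intro n J h hJ hh
  classical
  -- fugacities and edge parameters
  set z : Fin n → ℂ := fun i => Complex.exp (-2 * h i) with hz
  set t : Fin n → Fin n → ℝ := fun i j => Real.exp (-2 * J i j) with ht
  have hzlt : ∀ i, ‖z i‖ < 1 := by
    intro i
    rw [hz]
    simp only [Complex.norm_exp]
    rw [Real.exp_lt_one_iff]
    have := hh i
    simp only [Complex.mul_re, Complex.neg_re, Complex.neg_im, Complex.re_ofNat, Complex.im_ofNat]
    nlinarith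
  have ht0 : ∀ i j, 0 ≤ t i j := fun i j => (Real.exp_pos _).le
  have ht1 : ∀ i j, t i j ≤ 1 := fun i j => by
    rw [ht]; simp only [Real.exp_le_one_iff]; nlinarith [hJ i j]
  have hLY := lyProp_prod_edges t ht0 ht1 Finset.univ z hzlt
  -- per-configuration factorisation of the Boltzmann weight
  have hterm : ∀ σ : Fin n → Bool,
      Complex.exp ((∑ i, ∑ j, ((J i j : ℂ) * (if σ i = σ j then 1 else -1))) +
        ∑ i, h i * (if σ i then 1 else -1)) =
      ((∏ i, ∏ j, Complex.exp (J i j)) * ∏ i, Complex.exp (h i)) *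
        ((∏ p : Fin n × Fin n, (if σ p.1 = σ p.2 then 1 else (t p.1 p.2 : ℂ))) *
          ∏ i, (if σ i then 1 else z i)) := by
    intro σ
    rw [Complex.exp_add, Complex.exp_sum, Complex.exp_sum, Fintype.prod_prod_type]
    simp_rw [Complex.exp_sum]
    have eJ : ∀ i j, Complex.exp ((J i j : ℂ) * (if σ i = σ j then 1 else -1)) =
        Complex.exp (J i j) * (if σ i = σ j then 1 else (t i j : ℂ)) := by
      intro i j
      split_ifs with hs
      · simp
      · rw [ht]
        simp only [Complex.ofReal_exp, ← Complex.exp_add]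
        congr 1
        push_cast
        ring
    have eh : ∀ i, Complex.exp (h i * (if σ i then 1 else -1)) =
        Complex.exp (h i) * (if σ i then 1 else z i) := by
      intro i
      split_ifs with hs
      · simp
      · rw [hz, ← Complex.exp_add]
        congr 1
        ring
    simp_rw [eJ, eh, Finset.prod_mul_distrib]
    ring
  simp_rw [hterm]
  rw [← Finset.mul_sum]
  refine mul_ne_zero (mul_ne_zero ?_ ?_) ?_
  · exact Finset.prod_ne_zero_iff.mpr fun i _ =>
      Finset.prod_ne_zero_iff.mpr fun j _ => Complex.exp_ne_zero _
  · exact Finset.prod_ne_zero_iff.mpr fun i _ => Complex.exp_ne_zero _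
  · exact hLY

end Literature.Probability.LatticeModels

end
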